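import Summits.ValiantsHypothesis.ValiantsHypothesis.Theorems.NewtonUnitEquationsTwoProductsExpBlockTruncExp

/-!
# K10 `exp-block-tensorisation` — L1 PROVED: `expTensorCoeff_holds : ExpTensorCoeff` (cumulants vs. moments on graded fibres)

K10c, first half (val-idea-crit-8 g2's queue 20:38:11Z).  On a `BlockGraded` alphabet, at the point `p = k.sum` of a non-zero multiset `k` of
letters with at most `m` letters per block (`R := |k|`, `R_B := |k ∩ B|`):
`logDiff u v p = (−1)^{R+1} (R−1)! · coeff_p 𝒲`, `𝒲 = expTensor blk u v`.  Proof for one tail `q` (then sum over `j` and subtract):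
GRADING — every multiset of letters of `A` with sum `p` has the block counts of `k` (`BlockGraded`), so (G1) `coeff_p (q^r) = 0` unless `r = R`,
(G2) `coeff_p (∏_B q_B^{ρ_B}) = 0` unless `ρ = (R_B)_B` (`q_B` = block restrictions); hence `logCoeff q p = (−1)^{R+1}/R · coeff_p(q^R)`,
`coeff_p (E_N q) = coeff_p(q^R)/R!` and `coeff_p (∏_B E_{N'} q_B)` does not depend on the truncation order `N' ≥ max_B R_B` (so `N' = m` may be
replaced by a large `N`); MULTIPLICATIVITY — `∏_B E_N(q_B) ≡ E_N(Σ_B q_B) = E_N(q)` below degree `N` (`…ExpBlockTruncExp`).  Chain: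
`coeff_p ∏_B E_m(q_B) = coeff_p ∏_B E_N(q_B) = coeff_p E_N(q) = coeff_p(q^R)/R!` and `(−1)^{R+1}/R = (−1)^{R+1}(R−1)!/R!`.
Helper mode (`--supports stmt-ValiantsHypothesis-5906 --as helper`).  Honest framing: the identity L1 of the K10 card; the quasi-polynomial corollary still
needs L2 (`…ExpBlockTensorVisible`); nothing here closes 5906 or 5905; VP ≠ VNP is NOT proved.  No instances, no notation, no named facts. [folklore]
-/

noncomputable section
set_option linter.dupNamespace false

namespace Summit.ValiantsHypothesis.ValiantsHypothesis.Theorems.NewtonUnitEquations.TwoProducts.ExpBlock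

open MvPolynomial Finset
open Summit.ValiantsHypothesis.ValiantsHypothesis.Theorems.NewtonUnitEquations.TwoProducts.FormalLogLinearisation
open Summit.ValiantsHypothesis.ValiantsHypothesis.Theorems.NewtonUnitEquations.TwoProducts.PlanarCell

variable {m b : ℕ}

/-! ## Multisets of letters, block by block -/

/-- The size of a multiset is the sum of its block counts. [folklore] -/
theorem card_eq_sum_card_filter (blk : Expo → Fin b) (k : Multiset Expo) :
    Multiset.card k = ∑ B, Multiset.card (k.filter (fun e => blk e = B)) := by
  classical
  induction k using Multiset.induction_on with
  | empty => simp
  | cons a k ih =>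
    have h : ∀ B, Multiset.card ((a ::ₘ k).filter (fun e => blk e = B)) =
        (if blk a = B then 1 else 0) + Multiset.card (k.filter (fun e => blk e = B)) := by
      intro B
      rw [Multiset.filter_cons]
      split_ifs <;> simp [add_comm]
    simp only [h, Finset.sum_add_distrib, Multiset.card_cons, ← ih]
    rw [Finset.sum_ite_eq]
    simp [add_comm]

/-- `k` is a GRADED multiset of letters for the block map: every multiset of letters of `A` with the same point has the same block
sums and block counts.  (`BlockGraded` gives this for `k` with `≤ m` letters per block, `ShallowGraded` for `k` with `≤ m` letters.) [folklore] -/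
def GradedAt (A : Finset Expo) (blk : Expo → Fin b) (k : Multiset Expo) : Prop :=
  ∀ k' : Multiset Expo, (∀ e ∈ k', e ∈ A) → k.sum = k'.sum →
    ∀ B, (k.filter (fun e => blk e = B)).sum = (k'.filter (fun e => blk e = B)).sum ∧
      Multiset.card (k.filter (fun e => blk e = B)) = Multiset.card (k'.filter (fun e => blk e = B))

/-- `BlockGraded` alphabets: multisets with at most `m` letters per block are graded. [folklore] -/
theorem gradedAt_of_blockGraded {A : Finset Expo} {blk : Expo → Fin b} {m : ℕ} (hG : BlockGraded A blk m) {k : Multiset Expo}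
    (hk : ∀ e ∈ k, e ∈ A) (hkm : ∀ B, Multiset.card (k.filter (fun e => blk e = B)) ≤ m) : GradedAt A blk k :=
  fun k' hk' hsum B => hG k k' hk hk' hkm hsum B

/-- `ShallowGraded` alphabets: multisets with at most `m` letters are graded. [folklore] -/
theorem gradedAt_of_shallowGraded {A : Finset Expo} {blk : Expo → Fin b} {m : ℕ} (hG : ShallowGraded A blk m) {k : Multiset Expo}
    (hk : ∀ e ∈ k, e ∈ A) (hkm : Multiset.card k ≤ m) : GradedAt A blk k :=
  fun k' hk' hsum B => hG k k' hk hk' hkm hsum B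

/-- A graded multiset and one with the same sum have the same block counts. [folklore] -/
theorem card_filter_eq_of_gradedAt {A : Finset Expo} {blk : Expo → Fin b} {k k' : Multiset Expo} (hG : GradedAt A blk k)
    (hk' : ∀ e ∈ k', e ∈ A) (hsum : k.sum = k'.sum) (B : Fin b) :
    Multiset.card (k'.filter (fun e => blk e = B)) = Multiset.card (k.filter (fun e => blk e = B)) :=
  ((hG k' hk' hsum B).2).symm

/-- A graded multiset and one with the same sum have the same size. [folklore] -/
theorem card_eq_of_gradedAt {A : Finset Expo} {blk : Expo → Fin b} {k k' : Multiset Expo} (hG : GradedAt A blk k)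
    (hk' : ∀ e ∈ k', e ∈ A) (hsum : k.sum = k'.sum) : Multiset.card k' = Multiset.card k := by
  rw [card_eq_sum_card_filter blk k, card_eq_sum_card_filter blk k']
  exact Finset.sum_congr rfl fun B _ => card_filter_eq_of_gradedAt hG hk' hsum B

/-- A graded multiset of letters contains no zero letter. [folklore] -/
theorem zero_not_mem_of_gradedAt {A : Finset Expo} {blk : Expo → Fin b} {k : Multiset Expo} (hG : GradedAt A blk k)
    (hk : ∀ e ∈ k, e ∈ A) : (0 : Expo) ∉ k := by
  intro h0
  have hk' : ∀ e ∈ k.erase 0, e ∈ A := fun e he => hk e (Multiset.mem_of_mem_erase he)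
  have hsum : k.sum = (k.erase 0).sum := by
    conv_lhs => rw [← Multiset.cons_erase h0]
    rw [Multiset.sum_cons, zero_add]
  have h := card_eq_of_gradedAt hG hk' hsum
  have := Multiset.card_erase_add_one h0
  omega

/-- A multiset of NON-ZERO letters has at most `deg (k.sum)` elements. [folklore] -/
theorem card_le_degree_sum (k : Multiset Expo) (h0 : (0 : Expo) ∉ k) : Multiset.card k ≤ (k.sum).degree := by
  induction k using Multiset.induction_on with
  | empty => simp
  | cons a k ih =>
    rw [Multiset.card_cons, Multiset.sum_cons, map_add]
    have ha : a ≠ 0 := fun h => h0 (h ▸ Multiset.mem_cons_self a k)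
    have h1 : 1 ≤ a.degree := by
      rw [Nat.one_le_iff_ne_zero, Ne, Finsupp.degree_eq_zero_iff]
      exact ha
    have h2 := ih fun h => h0 (Multiset.mem_cons_of_mem h)
    omega

/-! ## Supports of products -/

/-- A support point of a finite product is a sum of support points of the factors. [folklore] -/
theorem exists_of_mem_support_prod {ι : Type*} [DecidableEq ι] (s : Finset ι) (P : ι → MvPolynomial (Fin 2) ℂ) (n : Expo)
    (hn : n ∈ (∏ i ∈ s, P i).support) : ∃ d : ι → Expo, (∀ i ∈ s, d i ∈ (P i).support) ∧ ∑ i ∈ s, d i = n := by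
  classical
  induction s using Finset.induction_on generalizing n with
  | empty =>
    rw [Finset.prod_empty] at hn
    have : n = 0 := by
      have h := support_one (R := ℂ) (σ := Fin 2) ▸ hn
      simpa using h
    exact ⟨fun _ => 0, fun i hi => absurd hi (Finset.notMem_empty i), by simp [this]⟩
  | insert a s ha ih =>
    rw [Finset.prod_insert ha] at hn
    obtain ⟨x, hx, y, hy, rfl⟩ := Finset.mem_add.1 (support_mul _ _ hn)
    obtain ⟨d, hd, hds⟩ := ih y hy
    refine ⟨Function.update d a x, fun i hi => ?_, ?_⟩
    · rcases Finset.mem_insert.1 hi with rfl | hi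
      · simpa using hx
      · have : i ≠ a := fun h => ha (by rwa [h] at hi)
        simpa [Function.update_of_ne this] using hd i hi
    · rw [Finset.sum_insert ha, Function.update_self]
      congr 1
      rw [← hds]
      exact Finset.sum_congr rfl fun i hi => Function.update_of_ne (fun h => ha (by rwa [h] at hi)) _ _

/-- A block family of letter tuples (`g_B : Fin (r_B) → A_B`) packs into ONE multiset with block counts `r_B` and block sums `Σ_i g_B i`. [folklore] -/
theorem exists_multiset_of_blockFamily (A : Finset Expo) (blk : Expo → Fin b) (r : Fin b → ℕ) (g : (B : Fin b) → Fin (r B) → Expo)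
    (hg : ∀ B i, g B i ∈ A.filter (fun e => blk e = B)) :
    ∃ k : Multiset Expo, (∀ e ∈ k, e ∈ A) ∧ (∀ B, Multiset.card (k.filter (fun e => blk e = B)) = r B) ∧
      (∀ B, (k.filter (fun e => blk e = B)).sum = ∑ i, g B i) ∧ k.sum = ∑ B, ∑ i, g B i := by
  classical
  set M : Fin b → Multiset Expo := fun B => (Finset.univ : Finset (Fin (r B))).val.map (g B) with hM
  have hfil : ∀ B, (∑ B', M B').filter (fun e => blk e = B) = M B := by
    intro B
    rw [multiset_filter_finset_sum, Finset.sum_eq_single B]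
    · rw [Multiset.filter_eq_self]
      intro e he
      obtain ⟨i, -, rfl⟩ := Multiset.mem_map.1 he
      exact (Finset.mem_filter.1 (hg B i)).2
    · intro B' _ hne
      rw [Multiset.filter_eq_nil]
      intro e he
      obtain ⟨i, -, rfl⟩ := Multiset.mem_map.1 he
      intro h
      exact hne ((Finset.mem_filter.1 (hg B' i)).2.symm.trans h)
    · intro h
      exact absurd (Finset.mem_univ B) h
  have hMsum : ∀ B, (M B).sum = ∑ i, g B i := fun B => by
    rw [hM]
    simp only
    rw [← Finset.sum_eq_multiset_sum]
  refine ⟨∑ B, M B, ?_, ?_, ?_, ?_⟩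
  · intro e he
    obtain ⟨B, -, heB⟩ := Multiset.mem_sum.1 he
    obtain ⟨i, -, rfl⟩ := Multiset.mem_map.1 heB
    exact (Finset.mem_filter.1 (hg B i)).1
  · intro B
    rw [hfil B, hM]
    simp only [Multiset.card_map, Finset.card_val, Finset.card_univ, Fintype.card_fin]
  · intro B
    rw [hfil B, hMsum]
  · rw [multiset_sum_finset_sum]
    exact Finset.sum_congr rfl fun B _ => hMsum B

/-! ## Grading consequences at a graded multiset -/

section Grading

variable {A : Finset Expo} {blk : Expo → Fin b} (q : MvPolynomial (Fin 2) ℂ)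
  (hqA : q.support ⊆ A) (k : Multiset Expo) (hG : GradedAt A blk k) (hk : ∀ e ∈ k, e ∈ A)
include hqA hG

/-- (G1) Only the `|k|`-th power of a tail reaches the point `k.sum`. [folklore] -/
theorem eq_card_of_coeff_pow_ne_zero (r : ℕ) (h : coeff k.sum (q ^ r) ≠ 0) : r = Multiset.card k := by
  classical
  obtain ⟨g, hg, hgs⟩ := mem_support_pow q r _ (mem_support_iff.2 h)
  have hk'A : ∀ e ∈ (Finset.univ : Finset (Fin r)).val.map g, e ∈ A := by
    intro e he
    obtain ⟨i, -, rfl⟩ := Multiset.mem_map.1 he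
    exact hqA (hg i)
  have hk's : k.sum = ((Finset.univ : Finset (Fin r)).val.map g).sum := by
    rw [← Finset.sum_eq_multiset_sum, hgs]
  have := card_eq_of_gradedAt hG hk'A hk's
  simpa using this

/-- (G2) Only the block powers `(R_B)_B` of the block restrictions reach the point `k.sum`. [folklore] -/
theorem eq_card_filter_of_coeff_prod_pow_ne_zero (ρ : Fin b → ℕ)
    (h : coeff k.sum (∏ B, (restrictBlock blk B q) ^ (ρ B)) ≠ 0) :
    ∀ B, ρ B = Multiset.card (k.filter (fun e => blk e = B)) := by
  classical
  obtain ⟨d, hd, hds⟩ := exists_of_mem_support_prod Finset.univ _ _ (mem_support_iff.2 h)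
  have hd' : ∀ B, ∃ g : Fin (ρ B) → Expo, (∀ i, g i ∈ A.filter (fun e => blk e = B)) ∧ ∑ i, g i = d B := by
    intro B
    obtain ⟨g, hg, hgs⟩ := mem_support_pow _ (ρ B) (d B) (hd B (Finset.mem_univ B))
    exact ⟨g, fun i => support_restrictBlock_subset blk B q A hqA (hg i), hgs⟩
  choose g hg hgd using hd'
  obtain ⟨k', hk'A, hk'card, -, hk'sum⟩ := exists_multiset_of_blockFamily A blk ρ g hg
  have hks : k.sum = k'.sum := by
    rw [hk'sum, ← hds]
    exact (Finset.sum_congr rfl fun B _ => hgd B).symm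
  intro B
  rw [← hk'card B]
  exact (card_filter_eq_of_gradedAt hG hk'A hks B)

/-- (G3) The coefficient at `k.sum` of a product of block truncated exponentials does not depend on the truncation order beyond the block
counts of `k`: it is `∏_B (R_B!)⁻¹ · coeff (∏_B q_B^{R_B})`. [folklore] -/
theorem coeff_prod_truncExp (N' : ℕ) (hN' : ∀ B, Multiset.card (k.filter (fun e => blk e = B)) ≤ N') :
    coeff k.sum (∏ B, truncExp N' (restrictBlock blk B q)) =
      (∏ B, ((Nat.factorial (Multiset.card (k.filter (fun e => blk e = B))) : ℂ)⁻¹)) *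
        coeff k.sum (∏ B, (restrictBlock blk B q) ^ (Multiset.card (k.filter (fun e => blk e = B)))) := by
  classical
  have hexp : (∏ B, truncExp N' (restrictBlock blk B q)) =
      ∑ ρ ∈ Fintype.piFinset (fun _ : Fin b => Finset.range (N' + 1)),
        C (∏ B, ((Nat.factorial (ρ B) : ℂ)⁻¹)) * ∏ B, (restrictBlock blk B q) ^ (ρ B) := by
    unfold truncExp
    simp_rw [MvPolynomial.smul_eq_C_mul]
    rw [Finset.prod_univ_sum]
    refine Finset.sum_congr rfl fun ρ _ => ?_
    rw [Finset.prod_mul_distrib, map_prod]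
  rw [hexp, coeff_sum]
  simp_rw [coeff_C_mul]
  rw [Finset.sum_eq_single (fun B => Multiset.card (k.filter (fun e => blk e = B)))]
  · intro ρ _ hne
    have : coeff k.sum (∏ B, (restrictBlock blk B q) ^ (ρ B)) = 0 := by
      by_contra h
      exact hne (funext (eq_card_filter_of_coeff_prod_pow_ne_zero q hqA k hG ρ h))
    rw [this, mul_zero]
  · intro h
    exact absurd (Fintype.mem_piFinset.2 fun B => Finset.mem_range.2 (Nat.lt_succ_of_le (hN' B))) h

/-- (G4) The truncated exponential at `k.sum`: `coeff (E_N q) = coeff(q^R)/R!` for `N ≥ R = |k|`. [folklore] -/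
theorem coeff_truncExp_eq (N : ℕ) (hN : Multiset.card k ≤ N) :
    coeff k.sum (truncExp N q) = ((Nat.factorial (Multiset.card k) : ℂ)⁻¹) * coeff k.sum (q ^ Multiset.card k) := by
  classical
  unfold truncExp
  rw [coeff_sum]
  simp_rw [coeff_smul, smul_eq_mul]
  rw [Finset.sum_eq_single (Multiset.card k)]
  · intro r _ hr
    have : coeff k.sum (q ^ r) = 0 := by
      by_contra h
      exact hr (eq_card_of_coeff_pow_ne_zero q hqA k hG r h)
    rw [this, mul_zero]
  · intro h
    exact absurd (Finset.mem_range.2 (Nat.lt_succ_of_le hN)) h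

include hk in
/-- (G5) The formal logarithm at `k.sum`: `logCoeff q (k.sum) = (−1)^{R+1}/R · coeff(q^R)`, `R = |k| ≥ 1`. [folklore] -/
theorem logCoeff_eq (hk0 : k ≠ 0) :
    logCoeff q k.sum = (-1 : ℂ) ^ (Multiset.card k + 1) / (Multiset.card k : ℂ) * coeff k.sum (q ^ Multiset.card k) := by
  classical
  unfold logCoeff
  rw [Finset.sum_eq_single (Multiset.card k)]
  · intro r _ hr
    have : coeff k.sum (q ^ r) = 0 := by
      by_contra h
      exact hr (eq_card_of_coeff_pow_ne_zero q hqA k hG r h)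
    rw [this, mul_zero]
  · intro h
    exfalso
    apply h
    rw [Finset.mem_Icc]
    refine ⟨Multiset.card_pos.2 hk0, ?_⟩
    have h1 := card_le_degree_sum k (zero_not_mem_of_gradedAt hG hk)
    rw [degree_fin_two] at h1
    exact h1

include hk in
/-- **L1 for one tail**: `logCoeff q (k.sum) = (−1)^{R+1} (R−1)! · coeff_{k.sum} (∏_B E_m(q_B))` for every truncation order `m` at least the
block counts of `k`. [folklore] -/
theorem logCoeff_eq_coeff_prod_truncExp (hq0 : coeff 0 q = 0) (hk0 : k ≠ 0) (m : ℕ)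
    (hkm : ∀ B, Multiset.card (k.filter (fun e => blk e = B)) ≤ m) :
    logCoeff q k.sum = (-1 : ℂ) ^ (Multiset.card k + 1) * (Nat.factorial (Multiset.card k - 1) : ℂ) *
      coeff k.sum (∏ B, truncExp m (restrictBlock blk B q)) := by
  classical
  set N : ℕ := m + (k.sum).degree with hN
  -- (1) truncation order `m` ↦ `N`
  have h1 : coeff k.sum (∏ B, truncExp m (restrictBlock blk B q)) = coeff k.sum (∏ B, truncExp N (restrictBlock blk B q)) := by
    rw [coeff_prod_truncExp q hqA k hG m hkm, coeff_prod_truncExp q hqA k hG N fun B => (hkm B).trans (Nat.le_add_right _ _)]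
  -- (2) multiplicativity below degree `N`
  have h2 : coeff k.sum (∏ B, truncExp N (restrictBlock blk B q)) = coeff k.sum (truncExp N q) := by
    have h := lowEq_prod_truncExp N (Finset.univ : Finset (Fin b)) (fun B => restrictBlock blk B q)
      (fun B _ => coeff_zero_restrictBlock blk B hq0)
    rw [sum_restrictBlock] at h
    exact h k.sum (Nat.le_add_left _ _)
  -- (3) the truncated exponential of `q` itself
  have hRdeg : Multiset.card k ≤ (k.sum).degree := card_le_degree_sum k (zero_not_mem_of_gradedAt hG hk)
  have h3 := coeff_truncExp_eq q hqA k hG N (hRdeg.trans (Nat.le_add_left _ _))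
  -- (4) the logarithm
  have h4 := logCoeff_eq q hqA k hG hk hk0
  rw [h4, h1, h2, h3]
  -- arithmetic
  have hR1 : 1 ≤ Multiset.card k := Multiset.card_pos.2 hk0
  have hfact : (Nat.factorial (Multiset.card k) : ℂ) = (Multiset.card k : ℂ) * (Nat.factorial (Multiset.card k - 1) : ℂ) := by
    rw [← Nat.mul_factorial_pred (by omega : Multiset.card k ≠ 0)]
    push_cast
    ring
  have hR0 : (Multiset.card k : ℂ) ≠ 0 := by exact_mod_cast (by omega : Multiset.card k ≠ 0)
  have hF0 : (Nat.factorial (Multiset.card k - 1) : ℂ) ≠ 0 := by exact_mod_cast (Nat.factorial_pos _).ne'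
  rw [hfact]
  field_simp

end Grading

/-- **K10 L1 — `expTensorCoeff_holds : ExpTensorCoeff`** (val-idea-37 g2's L1, text in `…ExpBlockTensor`): on a block-graded alphabet, at every
frame point `p = k.sum` (`k ≠ 0`, at most `m` letters per block), `logDiff u v p = (−1)^{|k|+1} (|k|−1)! · coeff_p 𝒲`. [folklore] -/
theorem expTensorCoeff_holds : ExpTensorCoeff := by
  intro m b u v A blk hu hv hG k hk hkm hk0
  classical
  have hu' : ∀ j, logCoeff (u j) k.sum = (-1 : ℂ) ^ (Multiset.card k + 1) * (Nat.factorial (Multiset.card k - 1) : ℂ) *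
      coeff k.sum (∏ B, truncExp m (restrictBlock blk B (u j))) := fun j =>
    logCoeff_eq_coeff_prod_truncExp (u j) (hu j).2 k (gradedAt_of_blockGraded hG hk hkm) hk (hu j).1 hk0 m hkm
  have hv' : ∀ j, logCoeff (v j) k.sum = (-1 : ℂ) ^ (Multiset.card k + 1) * (Nat.factorial (Multiset.card k - 1) : ℂ) *
      coeff k.sum (∏ B, truncExp m (restrictBlock blk B (v j))) := fun j =>
    logCoeff_eq_coeff_prod_truncExp (v j) (hv j).2 k (gradedAt_of_blockGraded hG hk hkm) hk (hv j).1 hk0 m hkm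
  unfold logDiff expTensor
  rw [coeff_sub, coeff_sum, coeff_sum, Finset.sum_congr rfl (fun j _ => hu' j), Finset.sum_congr rfl (fun j _ => hv' j),
    ← Finset.mul_sum, ← Finset.mul_sum, ← mul_sub]

end Summit.ValiantsHypothesis.ValiantsHypothesis.Theorems.NewtonUnitEquations.TwoProducts.ExpBlock

end
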